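import Mathlib
import HarnessLib
import Summits.NavierStokesRegularity.NavierStokesRegularity.Theorems.FrequencyGrowthExponent.Negative.Rigidity
import Summits.NavierStokesRegularity.NavierStokesRegularity.Theorems.ClockStretchingLawClockCeilingGermRigidity

/-!
# Crux `FrequencyGrowthExponent` (stmt-NavierStokesRegularity-27893), negative side:
# germ rigidity — time-recurrent profiles carry no vortex loop; a germ determines the loops

Negative-side (cdisprove, D-0016) bookkeeping for the wall `LoopPeriodRatchet.FrequencyGrowthExponent`; nothing here
closes or changes any item (`--supports`).  Companion of `Negative/Rigidity`: corollaries, in the class vocabulary of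
the wall, of the tree's GERM RIGIDITY of the KNSS-gauge Type-I class (`germRigidity`, `eq_zero_of_germ_timeRecurrent`:
joint real-analyticity on the open past slab plus the Type-I rate at `−∞`):

* `eq_zero_of_germ_timeRecurrent'` / `no_loop_of_germ_timeRecurrent` — a profile with `v(t₀ − δ, ·) = v(t₀, ·)` on a
  non-empty open set (one `t₀ < 0`, one `δ > 0`) vanishes identically: no steady (`no_loop_of_steady`), time-periodic
  or locally breathing profile is a witness `W`;
* `isVortexLoop_iff_of_germ_eq` — two class profiles agreeing on a non-empty open set at one time carry the same
  vortex loops on every slice (they coincide on the whole past).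

HONEST FRAMING: corollaries of landed theorems, recorded for the W-census of the negation-first reading (req192);
nothing here bears on `PoloidalWindowDoor.Target` or on Navier–Stokes regularity; item 27893 stays OPEN.
-/

noncomputable section

-- the summit and its single sub-problem share the name (CONVENTIONS §1), as in every Theorems file
set_option linter.dupNamespace false

namespace Summit.NavierStokesRegularity.NavierStokesRegularity.Theorems.FrequencyGrowthExponent.Negative

open Set Function Filter Topology MeasureTheory
open scoped RealInnerProductSpace InnerProductSpace
open Literature.Analysis Literature.Analysis.FluidPDE Literature.Analysis.UnboundedOperators
open Summit.NavierStokesRegularity.NavierStokesRegularity.Theorems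
open Summit.NavierStokesRegularity.NavierStokesRegularity.Theorems.PoloidalWindowDoorPoloidalWindowRigidityWindow

variable {C : ℝ} {v : ℝ → EuclideanSpace ℝ (Fin 3) → EuclideanSpace ℝ (Fin 3)}

/-! ### Time-recurrent germs -/

/-- **A time-recurrent germ kills the profile**: if `v(t₀ − δ, ·) = v(t₀, ·)` on a non-empty open set `U` for one
`t₀ < 0` and one `δ > 0` (in particular if the profile is steady or time-periodic), the class profile vanishes
identically (germ rigidity makes it `δ`-periodic in time, and the Type-I rate decays at `−∞`).
[cite: KochNadirashviliSereginSverak2009, §1 p. 3 and (1.4) (arXiv:0709.3599)] -/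
theorem eq_zero_of_germ_timeRecurrent' (hrate : HasTypeITimeDecay C v)
    (hcont : ContinuousOn (uncurry v) (Iio (0 : ℝ) ×ˢ univ))
    (hmild : ∀ s t : ℝ, s < t → t < 0 → ∀ x, v t x = heatExtension (v s) (t - s) x - oseenDuhamel 1 s v v t x)
    (hdiv : ∀ t < 0, VectorCalculus.IsDivFree (v t)) {δ : ℝ} (hδ : 0 < δ) {t₀ : ℝ} (ht₀ : t₀ < 0)
    {U : Set (EuclideanSpace ℝ (Fin 3))} (hU : IsOpen U) (hne : U.Nonempty)
    (heq : ∀ x ∈ U, v (t₀ - δ) x = v t₀ x) : ∀ t < 0, ∀ x, v t x = 0 :=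
  eq_zero_of_germ_timeRecurrent (isTypeIAncientMild_of_class hrate hcont hmild hdiv) hδ ht₀ hU hne heq

/-- **Time-recurrent germs carry no loop** (no steady, time-periodic or locally breathing witness). -/
theorem no_loop_of_germ_timeRecurrent (hrate : HasTypeITimeDecay C v)
    (hcont : ContinuousOn (uncurry v) (Iio (0 : ℝ) ×ˢ univ))
    (hmild : ∀ s t : ℝ, s < t → t < 0 → ∀ x, v t x = heatExtension (v s) (t - s) x - oseenDuhamel 1 s v v t x)
    (hdiv : ∀ t < 0, VectorCalculus.IsDivFree (v t)) {δ : ℝ} (hδ : 0 < δ) {t₀ : ℝ} (ht₀ : t₀ < 0)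
    {U : Set (EuclideanSpace ℝ (Fin 3))} (hU : IsOpen U) (hne : U.Nonempty)
    (heq : ∀ x ∈ U, v (t₀ - δ) x = v t₀ x) {t : ℝ} (ht : t < 0) (c : ℝ → EuclideanSpace ℝ (Fin 3)) (T : ℝ) :
    ¬ IsVortexLoop v t c T :=
  no_loop_of_eq_zero (eq_zero_of_germ_timeRecurrent' hrate hcont hmild hdiv hδ ht₀ hU hne heq) ht c T

/-- **Steady profiles carry no loop** (the case `U = ℝ³`, any `δ > 0`, of the previous theorem). -/
theorem no_loop_of_steady (hrate : HasTypeITimeDecay C v)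
    (hcont : ContinuousOn (uncurry v) (Iio (0 : ℝ) ×ˢ univ))
    (hmild : ∀ s t : ℝ, s < t → t < 0 → ∀ x, v t x = heatExtension (v s) (t - s) x - oseenDuhamel 1 s v v t x)
    (hdiv : ∀ t < 0, VectorCalculus.IsDivFree (v t)) (hsteady : ∀ s t : ℝ, s < 0 → t < 0 → v s = v t)
    {t : ℝ} (ht : t < 0) (c : ℝ → EuclideanSpace ℝ (Fin 3)) (T : ℝ) : ¬ IsVortexLoop v t c T :=
  no_loop_of_germ_timeRecurrent hrate hcont hmild hdiv one_pos (t₀ := -1) (by norm_num) isOpen_univ univ_nonempty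
    (fun x _ => by rw [hsteady (-1 - 1) (-1) (by norm_num) (by norm_num)]) ht c T

/-! ### A germ determines the loops -/

/-- **Germ rigidity of the loop structure**: two class profiles (constants `C`, `C'`) that agree on a non-empty open
set at ONE time `t₀ < 0` carry the same vortex loops on every slice — they are the same profile on the whole past
(`germRigidity`, joint real-analyticity of the class). [cite: KochNadirashviliSereginSverak2009, Remark 6.1 (arXiv:0709.3599)] -/
theorem isVortexLoop_iff_of_germ_eq {C' : ℝ} {w : ℝ → EuclideanSpace ℝ (Fin 3) → EuclideanSpace ℝ (Fin 3)}
    (hrate : HasTypeITimeDecay C v) (hcont : ContinuousOn (uncurry v) (Iio (0 : ℝ) ×ˢ univ))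
    (hmild : ∀ s t : ℝ, s < t → t < 0 → ∀ x, v t x = heatExtension (v s) (t - s) x - oseenDuhamel 1 s v v t x)
    (hdiv : ∀ t < 0, VectorCalculus.IsDivFree (v t))
    (hrate' : HasTypeITimeDecay C' w) (hcont' : ContinuousOn (uncurry w) (Iio (0 : ℝ) ×ˢ univ))
    (hmild' : ∀ s t : ℝ, s < t → t < 0 → ∀ x, w t x = heatExtension (w s) (t - s) x - oseenDuhamel 1 s w w t x)
    (hdiv' : ∀ t < 0, VectorCalculus.IsDivFree (w t)) {t₀ : ℝ} (ht₀ : t₀ < 0)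
    {U : Set (EuclideanSpace ℝ (Fin 3))} (hU : IsOpen U) (hne : U.Nonempty) (heq : ∀ x ∈ U, v t₀ x = w t₀ x)
    {t : ℝ} (ht : t < 0) (c : ℝ → EuclideanSpace ℝ (Fin 3)) (T : ℝ) :
    IsVortexLoop v t c T ↔ IsVortexLoop w t c T := by
  have hslice : v t = w t := funext fun x =>
    germRigidity (isTypeIAncientMild_of_class hrate hcont hmild hdiv)
      (isTypeIAncientMild_of_class hrate' hcont' hmild' hdiv') ht₀ hU hne heq ht x
  simp only [IsVortexLoop, hslice]

end Summit.NavierStokesRegularity.NavierStokesRegularity.Theorems.FrequencyGrowthExponent.Negative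

end
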